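import Literature.MeasureTheory.Group.InvariantQuotientTransport
import HarnessLib

/-!
# Covolumes of lattices are invariant under isomorphisms of topological groups (counting-measure form)
(Gelbart, *Automorphic forms on adele groups* (1975), Remark 9.23 p. 140: the volumes `meas(Z_∞⁺ G(γ)_ℚ \ G(γ)_𝔸)`; Rogawski (1990),
§14.5 pp. 237–238 (print): `a_γ = ε⁻¹ m(Z𝐆_γ \ 𝐆_γ)` and «the Haar measures on stably conjugate tori are chosen compatibly» §4.3 pp. 43–44)

Topic `MeasureTheory/Group`; theorems only (no definition, no named fact, no instance).  ★ `InvariantQuotientTransport` proves the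
naturality of the tree's quotient measures `quotientMeasure H ρ ν` (Weil constant one) along an isomorphism of topological groups
`e : G ≃* G'` carrying `H` onto `H'`: `quotientMeasure_univ_eq_of_mulEquiv` — total masses agree when `ρ' = (e|_H)_* ρ`, `ν' = e_* ν`.
For the COVOLUME OF A LATTICE the subgroup measure is the COUNTING measure, and `(e|_H)_*(count) = count` holds automatically; this file
records that special case, which is the shape in which the weights of the geometric side of the trace formula are read
(★ `UnitaryGroupDiagTraceNormalized`: `vol = quotientMeasure (G(K)_γ ≤ G_γ) count ν_γ (⊤)`):

* `map_subgroupCongrHomeomorph_count` — `(e|_H)_* count = count`;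
* `covolume_count_eq_of_mulEquiv` — **`quotientMeasure H' count ν' (⊤) = quotientMeasure H count ν (⊤)`** for `ν' = e_* ν`;
* `covolume_count_eq_of_mulEquiv'` — the same with the target Haar measure given up front and the hypothesis `Measure.map e ν = ν'`
  read as «`e` transports `ν` to `ν'`» (the form supplied by canonically normalised Haar measures on isomorphic tori).

WHY.  (M-C-4)(i) of the F0/P3a road «measure coherence»: for stably conjugate regular rational `γ, γ′` the adelic centralisers are
isomorphic topological groups by an isomorphism carrying `Z_γ(L⁺)` onto `Z_{γ′}(L⁺)` (★-to-be `adelicStableCentralizerEquiv_mem_arithmeticSubgroup_iff`)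
and the canonical torus measures to each other; hence the covolumes — the weights `a_γ` — agree: «β is constant on regular stable classes».

## References
* S. Gelbart, *Automorphic forms on adele groups*, Ann. of Math. Studies 83 (1975), Remark 9.23 [Gelbart1975].
* J. D. Rogawski, *Automorphic Representations of Unitary Groups in Three Variables*, Ann. of Math. Stud. 123 (1990), §4.3 pp. 43–44,
  §14.5 pp. 237–238 [Rogawski1990].
-/

noncomputable section

open _root_.MeasureTheory _root_.MeasureTheory.Measure _root_.Topology Set Filter
open scoped ENNReal NNReal Pointwise

/- The coset spaces carry the Borel structures supplied as binders (local instances take precedence over Mathlib's quotient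
σ-algebra instance), as in `InvariantQuotientTransport`. -/

namespace Literature.MeasureTheory.Group

section CountTransport

variable {G G' : Type*} [Group G] [Group G'] [TopologicalSpace G] [TopologicalSpace G']
  [IsTopologicalGroup G] [IsTopologicalGroup G']
  [MeasurableSpace G] [BorelSpace G] [MeasurableSpace G'] [BorelSpace G']
  (e : G ≃* G') (he : Continuous e) (hes : Continuous e.symm)
  (H : Subgroup G) (H' : Subgroup G') (hHH' : ∀ g, e g ∈ H' ↔ g ∈ H)

omit [IsTopologicalGroup G] [IsTopologicalGroup G'] in
/-- **The restriction of `e` to `H ≃ H'` carries the counting measure to the counting measure** (any bijection does, for the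
σ-algebras with measurable singletons carried by Hausdorff topological groups). [cite: Gelbart1975, Remark 9.23] -/
theorem map_subgroupCongrHomeomorph_count [MeasurableSingletonClass H] [MeasurableSingletonClass H'] :
    Measure.map (subgroupCongrHomeomorph e H H' hHH' he hes) (count : Measure H) = (count : Measure H') := by
  set φ : H ≃ᵐ H' := (subgroupCongrHomeomorph e H H' hHH' he hes).toMeasurableEquiv with hφ
  have hcoe : ⇑(subgroupCongrHomeomorph e H H' hHH' he hes) = ⇑φ := rfl
  rw [hcoe]
  ext s _
  rw [φ.map_apply, ← φ.image_symm, count_injective_image φ.symm.injective]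

end CountTransport

section Covolume

variable {G G' : Type*} [Group G] [Group G'] [TopologicalSpace G] [TopologicalSpace G']
  [IsTopologicalGroup G] [IsTopologicalGroup G'] [LocallyCompactSpace G] [LocallyCompactSpace G']
  [SecondCountableTopology G] [SecondCountableTopology G'] [T2Space G] [T2Space G']
  [MeasurableSpace G] [BorelSpace G] [MeasurableSpace G'] [BorelSpace G']
  (e : G ≃* G') (he : Continuous e) (hes : Continuous e.symm)
  (H : Subgroup G) [hH : IsClosed (H : Set G)] (H' : Subgroup G') [hH' : IsClosed (H' : Set G')]
  (hHH' : ∀ g, e g ∈ H' ↔ g ∈ H)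
  [MeasurableSpace (G ⧸ H)] [BorelSpace (G ⧸ H)] [MeasurableSpace (G' ⧸ H')] [BorelSpace (G' ⧸ H')]
  [MeasurableSingletonClass H] [MeasurableSingletonClass H']
  [(count : Measure H).IsMulLeftInvariant] [IsFiniteMeasureOnCompacts (count : Measure H)]
  [(count : Measure H).IsOpenPosMeasure] [(count : Measure H).IsInvInvariant] [SFinite (count : Measure H)]
  [(count : Measure H').IsMulLeftInvariant] [IsFiniteMeasureOnCompacts (count : Measure H')]
  [(count : Measure H').IsOpenPosMeasure] [(count : Measure H').IsInvInvariant] [SFinite (count : Measure H')]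
  (ν : Measure G) [IsHaarMeasure ν] [ν.IsMulRightInvariant]
  (ν' : Measure G') [IsHaarMeasure ν'] [ν'.IsMulRightInvariant]

include he hes hHH' in
/-- **Covolumes of lattices are transport-invariant**: for an isomorphism of topological groups `e : G ≃* G'` carrying the
(discrete) subgroup `H` onto `H'` and the Haar measure `ν` to `ν' = e_* ν`, the total masses of the quotient measures for the COUNTING
measures on `H`, `H'` agree: `quotientMeasure H' count ν' (⊤) = quotientMeasure H count ν (⊤)` — Gelbart's `meas(G(γ)_ℚ \ G(γ)_𝔸)` does not
see which of two isomorphic presentations of the torus is used. [cite: Gelbart1975, Remark 9.23] -/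
theorem covolume_count_eq_of_mulEquiv (hν' : ν' = Measure.map e ν) :
    quotientMeasure H' (count : Measure H') hH' ν' Set.univ = quotientMeasure H (count : Measure H) hH ν Set.univ :=
  quotientMeasure_univ_eq_of_mulEquiv e he hes H H' hHH' (count : Measure H) (count : Measure H') ν ν'
    (map_subgroupCongrHomeomorph_count e he hes H H' hHH').symm hν'

include he hes hHH' in
/-- The same, with the transport hypothesis written `Measure.map e ν = ν'` («`e` carries the normalised Haar measure of `G` to that of
`G'`», the form in which canonically normalised measures on isomorphic tori are compared). [cite: Rogawski1990, §4.3 pp. 43–44] -/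
theorem covolume_count_eq_of_mulEquiv' (hν' : Measure.map e ν = ν') :
    quotientMeasure H (count : Measure H) hH ν Set.univ = quotientMeasure H' (count : Measure H') hH' ν' Set.univ :=
  (covolume_count_eq_of_mulEquiv e he hes H H' hHH' ν ν' hν'.symm).symm

end Covolume

end Literature.MeasureTheory.Group
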